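import Mathlib
import Summits.ValiantsHypothesis.ValiantsHypothesis.Theses.LiouvilleSarnak
import Summits.ValiantsHypothesis.ValiantsHypothesis.Theorems.LiouvilleSarnakLiouvilleCutRankKernelEmbedding

/-!
# Route LiouvilleSarnak — crux `LiouvilleCutRank` (stmt-ValiantsHypothesis-14775):
# the KERNEL-BLOCK form — one rich block of one 2-kernel sequence of `λ` per cut word suffices

The one-block form (`Theorems/LiouvilleSarnakLiouvilleCutRankOneBlock.lean`) asks, for every cut word
`π₁` at one scale `n₁`, for SOME aligned block `[4^{n₁} H + 1, 4^{n₁}(H+1)]` of `λ` of `π₁`-rank `≥ W`.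
Using the bits BELOW the window as well (`Theorems/LiouvilleSarnakLiouvilleCutRankKernelEmbedding.lean`:
`rank (λ(2^s (N_{π₁}(r,c) + 4^{n₁} H) + Q + 1))_{r,c} ≤ rank M_π` for every `s`, `Q < 2^s`, `H`, given
margins), the hypothesis weakens further:

* `le_rank_of_kernelBlock` (quantitative), `liouvilleCutRank_of_kernelBlock`,
  `kernelBlock_of_liouvilleCutRank`, ★ `liouvilleCutRank_iff_kernelBlock`:

  `LiouvilleCutRank ⟺ ∀ W, ∃ n₁, ∀ π₁, ∃ s Q H, Q < 2^s ∧ W ≤ rank (λ(2^s (N_{π₁}(r,c) + 4^{n₁} H) + Q + 1))_{r,c}`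

  — for every balanced cut word at one scale it suffices that SOME aligned `4^{n₁}`-block of SOME
  2-kernel sequence `b ↦ λ(2^s b + ρ)` of the Liouville function (`ρ = Q + 1 ∈ [1, 2^s]`; `s = 0` is
  `λ` itself) has `π₁`-rank `≥ W`.  By Coons (tree: `coons_liouville_not_automatic_holds`) the 2-kernel
  of `λ` is infinite, so this is a large supply of sequences; the aligned rung `AlignedCutRank` used
  exactly that supply at `H = 0`.

Honest framing: structural (the strongest hypothesis-weakening the window method gives); the crux
`LiouvilleCutRank`, `DigitalBilinearLiouville` and `AlgebraicSarnak` stay OPEN, and nothing here bears on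
VP versus VNP.  No definitions (the kernel-block form is written out verbatim).
-/

-- the directory `ValiantsHypothesis/ValiantsHypothesis` repeats the summit name (tree layout)
set_option linter.dupNamespace false

namespace Summit.ValiantsHypothesis.ValiantsHypothesis.Theorems.LiouvilleSarnakLiouvilleCutRank.KernelBlock

open ArithmeticFunction

open Summit.ValiantsHypothesis.ValiantsHypothesis.Theses.LiouvilleSarnak (LiouvilleCutRank)
open Summit.ValiantsHypothesis.ValiantsHypothesis.Theorems.LiouvilleSarnakLiouvilleCutRank.OneScale
  (exists_inducedCut)

/-- **Scale transfer with kernel dilations and shifts.**  If for every balanced cut `π₁` at level `n₁`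
some aligned block `H < 2^T` of some 2-kernel sequence `b ↦ λ(2^s b + Q + 1)` with `s ≤ S`, `Q < 2^s`,
has `π₁`-rank `≥ W`, then every balanced cut matrix at every level `n ≥ (n₁ + 1)(n₁ + S + T)` has rank
`≥ W` (a balanced `2n₁`-window with `S` free positions below and `T` above, then the kernel embedding).
[folklore] -/
theorem le_rank_of_kernelBlock (W n₁ S T : ℕ)
    (h : ∀ π₁ : Fin n₁ ⊕ Fin n₁ ≃ Fin (2 * n₁), ∃ s ≤ S, ∃ Q < 2 ^ s, ∃ H < 2 ^ T,
      W ≤ (Matrix.of fun r c : Fin n₁ → Bool =>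
        (((liouville (2 ^ s * (Nat.ofBits (fun j : Fin (2 * n₁) => Sum.elim r c (π₁.symm j)) +
          2 ^ (2 * n₁) * H) + Q + 1) : ℤ) : ℂ))).rank)
    (n : ℕ) (hn : (n₁ + 1) * (n₁ + S + T) ≤ n) (π : Fin n ⊕ Fin n ≃ Fin (2 * n)) :
    W ≤ (Matrix.of fun r c : Fin n → Bool =>
      (((liouville (Nat.ofBits (fun j : Fin (2 * n) => Sum.elim r c (π.symm j)) + 1) : ℤ) :
        ℂ))).rank := by
  let w : ℕ → Bool := fun k => if hk : k < 2 * n then (π.symm ⟨k, hk⟩).isLeft else false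
  have hw : ∀ j : Fin (2 * n), w j = (π.symm j).isLeft := fun j => by simp [w, j.isLt]
  obtain ⟨s', hs'1, hs'2, hcount⟩ := exists_balancedWindow_margin₂ n₁ S T n hn π w hw
  obtain ⟨π₁, hπ₁⟩ := exists_inducedCut n₁ s' w hcount
  obtain ⟨s, hsS, Q, hQ, H, hHT, hW⟩ := h π₁
  have hH : H < 2 ^ (2 * n - (s' + 2 * n₁)) :=
    lt_of_lt_of_le hHT (Nat.pow_le_pow_right Nat.two_pos (by omega))
  exact hW.trans (rank_inducedCut_kernel_le n₁ n π w s' (by omega) (fun j _ _ => hw j) π₁ hπ₁ s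
    (hsS.trans hs'1) Q hQ H hH)

/-- **Kernel-block form ⇒ crux.**  Finitely many `π₁` at the scale `n₁` ⇒ uniform bounds `S` on the
dilation exponents and `B < 2^B` on the shifts; then `le_rank_of_kernelBlock` from level
`(n₁ + 1)(n₁ + S + B)` on. [folklore] -/
theorem liouvilleCutRank_of_kernelBlock
    (h : ∀ W : ℕ, ∃ n₁ : ℕ, ∀ π₁ : Fin n₁ ⊕ Fin n₁ ≃ Fin (2 * n₁), ∃ s Q H : ℕ, Q < 2 ^ s ∧
      W ≤ (Matrix.of fun r c : Fin n₁ → Bool =>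
        (((liouville (2 ^ s * (Nat.ofBits (fun j : Fin (2 * n₁) => Sum.elim r c (π₁.symm j)) +
          2 ^ (2 * n₁) * H) + Q + 1) : ℤ) : ℂ))).rank) :
    LiouvilleCutRank := by
  intro W
  obtain ⟨n₁, hn₁⟩ := h W
  choose fs fQ fH hfQ hfW using hn₁
  obtain ⟨S, hS⟩ := (Set.finite_range fs).bddAbove
  obtain ⟨B, hB⟩ := (Set.finite_range fH).bddAbove
  refine ⟨(n₁ + 1) * (n₁ + S + B), fun n hn π => ?_⟩
  exact le_rank_of_kernelBlock W n₁ S B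
    (fun π₁ => ⟨fs π₁, hS (Set.mem_range_self π₁), fQ π₁, hfQ π₁, fH π₁,
      lt_of_le_of_lt (hB (Set.mem_range_self π₁)) Nat.lt_two_pow_self, hfW π₁⟩) n hn π

/-- **Crux ⇒ kernel-block form** (trivial direction: `s = 0`, `Q = 0`, `H = 0` at the level `n₀` of
the crux). [folklore] -/
theorem kernelBlock_of_liouvilleCutRank (h : LiouvilleCutRank) :
    ∀ W : ℕ, ∃ n₁ : ℕ, ∀ π₁ : Fin n₁ ⊕ Fin n₁ ≃ Fin (2 * n₁), ∃ s Q H : ℕ, Q < 2 ^ s ∧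
      W ≤ (Matrix.of fun r c : Fin n₁ → Bool =>
        (((liouville (2 ^ s * (Nat.ofBits (fun j : Fin (2 * n₁) => Sum.elim r c (π₁.symm j)) +
          2 ^ (2 * n₁) * H) + Q + 1) : ℤ) : ℂ))).rank := by
  intro W
  obtain ⟨n₀, hn₀⟩ := h W
  refine ⟨n₀, fun π₁ => ⟨0, 0, 0, Nat.one_pos, ?_⟩⟩
  simpa using hn₀ n₀ le_rfl π₁

/-- ★ **`LiouvilleCutRank` ⟺ its KERNEL-BLOCK form.**  The crux holds iff for every `W` there is ONE
scale `n₁` such that for every balanced cut `π₁` of `2n₁` positions SOME aligned `4^{n₁}`-block of SOME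
2-kernel sequence `b ↦ λ(2^s b + Q + 1)` (`Q < 2^s`) of the Liouville function, read through `π₁` as the
sign matrix `(λ(2^s (N_{π₁}(r,c) + 4^{n₁} H) + Q + 1))_{r,c}`, has rank `≥ W`. [folklore] -/
theorem liouvilleCutRank_iff_kernelBlock :
    LiouvilleCutRank ↔
      ∀ W : ℕ, ∃ n₁ : ℕ, ∀ π₁ : Fin n₁ ⊕ Fin n₁ ≃ Fin (2 * n₁), ∃ s Q H : ℕ, Q < 2 ^ s ∧
        W ≤ (Matrix.of fun r c : Fin n₁ → Bool =>
          (((liouville (2 ^ s * (Nat.ofBits (fun j : Fin (2 * n₁) => Sum.elim r c (π₁.symm j)) +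
            2 ^ (2 * n₁) * H) + Q + 1) : ℤ) : ℂ))).rank :=
  ⟨kernelBlock_of_liouvilleCutRank, liouvilleCutRank_of_kernelBlock⟩

end Summit.ValiantsHypothesis.ValiantsHypothesis.Theorems.LiouvilleSarnakLiouvilleCutRank.KernelBlock
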